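import Summits.FinalStateConjecture.FinalStateConjecture.Theorems.EIHFluxBalanceEIHFluxEvaluationKSKerr
import Literature.Geometry.Lorentzian.CoordRicciCovariance
import Literature.Geometry.Lorentzian.BoostedKerrSchildDecay
import Summits.FinalStateConjecture.FinalStateConjecture.Theorems.EIHFluxBalanceInertialRecessionStubSlavingZeroSet
import Summits.FinalStateConjecture.FinalStateConjecture.Theorems.EIHFluxBalanceInertialRecessionPerforatedGauss

/-!
# Route EIHFluxBalance — `EIHFluxEvaluation` (c): the Landau–Lifshitz pseudotensor, complex and
# momentum flux of an exact BOOSTED Kerr black hole vanish identically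

Helper file (`--supports stmt-FinalStateConjecture-10188`): the boosted, translated Kerr–Schild
form `boostedKerrBilin Λ c M a` (`g_{M,a}(Λ⁻¹(x − c))(Λ⁻¹·, Λ⁻¹·)`, `KerrConvergence.lean`) of a
Kerr black hole in uniform motion `(Λ, c)`:

* the boosted components are the pull-back of the Kerr components by the change of coordinates
  `x ↦ Λ⁻¹(x − c)` (`SublinearIsFree.Slaving.pullMetric_kerr_bilin_poincareInv`,
  `…isCoordChangeOn_poincareInv`, `…isMetricOn_kerr_bilin`, file `…StubSlavingZeroSet`), so by the
  naturality of the coordinate Ricci form (`MetricCoord.IsMetricOn.ricAt_pullMetric_eq_zero`) and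
  `ricAt_kerr_eq_zero` they are vacuum wherever the rest-frame radius is positive
  (`ricAt_boostedKerr_eq_zero`, ALL spins — the `a = 0` case is
  `SublinearIsFree.Slaving.ricAt_boostedKerrBilin_zero_spin`);
* the boosted family is again a Kerr–Schild family in the mass, `η + M · K` with
  `K = 2H₁(ψ x) (ℓ∘Λ⁻¹) ⊗ (ℓ∘Λ⁻¹)` null rank-one (`η`-dual `Λ ℓ♯`; Lorentz invariance of `η`);
* hence (abstract vacuum theorems of `…KSVacuum`) `Σ_α∂_α h^{μνα} = 0`, `t^{μν}_LL = 0`, zero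
  momentum flux through and conserved quasi-local four-momentum of every coordinate sphere of the
  LAB frame inside the boosted chart domain, and sphere-independence of that four-momentum —
  UNCONDITIONALLY for all real `M, a, r₀` (Ricci-flatness of Kerr is the tree theorem
  `Kerr.isRicciFlat_holds`; a boosted Schwarzschild hole is the specialisation `a = 0`).

Physics: Gürses–Gürsey, J. Math. Phys. 16 (1975) 2385, §IV; Virbhadra, Phys. Rev. D 42 (1990) 2919.
-/

noncomputable section

open Filter Set
open scoped Matrix Topology ContDiff

namespace Summit.FinalStateConjecture.FinalStateConjecture.Theorems

namespace KSFlux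

open Literature.Geometry.Lorentzian Literature.Geometry.Lorentzian.LandauLifshitz
set_option maxSynthPendingDepth 3

open MeasureTheory MeasureTheory.Measure
open scoped Manifold

/-! ### The inverse Poincaré map as a change of coordinates; boosted Kerr is vacuum -/

section Boost

/-- **A boosted Kerr black hole is vacuum in the lab chart**: the coordinate Ricci form of
`boostedKerrBilin Λ c M a` vanishes at every `y` whose rest-frame point `Λ⁻¹(y − c)` has positive
Kerr–Schild radius, for all real `M, a` (all spins, unconditional): `ricAt_kerr_eq_zero`
transported by the naturality of the coordinate Ricci form under the change of coordinates
`x ↦ Λ⁻¹(x − c)`. [cite: ONeill1983, Ch. 3, Prop. 3.59] -/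
theorem ricAt_boostedKerr_eq_zero (Λ : lorentzGroup) (c : E4) (M a : ℝ) {y : E4}
    (hy : 0 < Kerr.radius a (poincareInv Λ c y)) :
    MetricCoord.ricAt (boostedKerrBilin Λ c M a) y = 0 := by
  have hy' : y ∈ poincareInv Λ c ⁻¹' (Kerr.region a 0 : Set E4) := by
    show poincareInv Λ c y ∈ (Kerr.region a 0 : Set E4)
    rw [SetLike.mem_coe, Kerr.mem_region, max_self]
    exact hy
  rw [← SublinearIsFree.Slaving.pullMetric_kerr_bilin_poincareInv]
  exact (SublinearIsFree.Slaving.isMetricOn_kerr_bilin M a).ricAt_pullMetric_eq_zero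
    (SublinearIsFree.Slaving.isCoordChangeOn_poincareInv Λ c a) hy' (ricAt_kerr_eq_zero M a 0 hy')

/-! ### The boosted family is a Kerr–Schild family in the mass -/

/-- **The mass is the Kerr–Schild parameter of the boosted family**:
`g_{M,a,Λ,c}(x) = η + M · (g_{1,a,Λ,c}(x) − η)` (Lorentz invariance of `η`, `H_M = M H₁`).
[cite: KerrSchild1965, §1] -/
theorem boostedKerrBilin_eq_ksFamily (Λ : lorentzGroup) (c : E4) (M a : ℝ) :
    boostedKerrBilin Λ c M a =
      fun x ↦ Minkowski.bilin + M • (boostedKerrBilin Λ c 1 a x - Minkowski.bilin) := by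
  funext x
  ext v w
  rw [boostedKerrBilin_apply, Kerr.bilin, Kerr.scalarH_eq_mul_scalarH_one M a]
  simp only [boostedKerrBilin_apply, Kerr.bilin, _root_.add_apply,
    _root_.smul_apply, _root_.sub_apply, E4.tmul_apply, smul_eq_mul,
    lorentzGroup.minkowski_symm_apply]
  ring

/-- **`K = g_{1,a,Λ,c} − η = 2H₁(ψ x) (ℓ∘Λ⁻¹) ⊗ (ℓ∘Λ⁻¹)` is null rank-one** wherever the rest-frame
radius is positive: the `η`-dual of `ℓ∘Λ⁻¹` is `Λ ℓ♯`, and `(ℓ∘Λ⁻¹)(Λ ℓ♯) = ℓ(ℓ♯) = 0`.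
[cite: KerrSchild1965, §1] -/
theorem boostedKerr_nullRankOne (Λ : lorentzGroup) (c : E4) (a : ℝ) {x : E4}
    (hx : 0 < Kerr.radius a (poincareInv Λ c x)) :
    ∃ φ : ℝ, ∃ ℓ : E4 →L[ℝ] ℝ, ∃ n : E4, (∀ w, Minkowski.bilin n w = ℓ w) ∧ ℓ n = 0 ∧
      boostedKerrBilin Λ c 1 a x - Minkowski.bilin = φ • E4.tmul ℓ ℓ := by
  refine ⟨2 * Kerr.scalarH 1 a (poincareInv Λ c x),
    (Kerr.nullCovector a (poincareInv Λ c x)).comp ((Λ : E4 ≃L[ℝ] E4).symm : E4 →L[ℝ] E4),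
    (Λ : E4 ≃L[ℝ] E4) (Kerr.nullVector a (poincareInv Λ c x)), fun w ↦ ?_, ?_, ?_⟩
  · have h := Λ.2 (Kerr.nullVector a (poincareInv Λ c x)) ((Λ : E4 ≃L[ℝ] E4).symm w)
    rw [ContinuousLinearEquiv.apply_symm_apply] at h
    rw [h, Kerr.bilin_nullVector]
    rfl
  · rw [ContinuousLinearMap.comp_apply, ContinuousLinearEquiv.coe_coe,
      ContinuousLinearEquiv.symm_apply_apply]
    exact Kerr.nullCovector_nullVector hx
  · ext v w
    simp only [_root_.sub_apply, boostedKerrBilin_apply, Kerr.bilin,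
      _root_.add_apply, _root_.smul_apply, E4.tmul_apply,
      ContinuousLinearMap.comp_apply, ContinuousLinearEquiv.coe_coe, smul_eq_mul,
      lorentzGroup.minkowski_symm_apply]
    ring

/-- `K = g_{1,a,Λ,c} − η` is `C^∞` on the boosted chart domain `ψ⁻¹(Kerr.region a r₀)`.
[cite: KerrSchild1965, §3] -/
theorem contDiffOn_boostedKerr_sub_minkowski (Λ : lorentzGroup) (c : E4) (a r₀ : ℝ) :
    ContDiffOn ℝ ∞ (fun x ↦ boostedKerrBilin Λ c 1 a x - Minkowski.bilin)
      (poincareInv Λ c ⁻¹' (Kerr.region a r₀ : Set E4)) :=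
  fun _ hx ↦ ((contDiffAt_boostedKerrBilin Λ c 1 a (Kerr.radius_pos_of_mem_region hx)).sub
    contDiffAt_const).contDiffWithinAt

/-- The boosted chart domain `ψ⁻¹(Kerr.region a r₀)` is open. [folklore] -/
theorem isOpen_preimage_region (Λ : lorentzGroup) (c : E4) (a r₀ : ℝ) :
    IsOpen (poincareInv Λ c ⁻¹' (Kerr.region a r₀ : Set E4)) :=
  (Kerr.region a r₀).isOpen.preimage (continuous_poincareInv Λ c)

/-- On the boosted chart domain the boosted components are vacuum parameters of the Kerr–Schild
family `η + M K` for every mass. [cite: KerrSchild1965, §3] -/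
theorem ricAt_boostedKerr_ksFamily_eq_zero (Λ : lorentzGroup) (c : E4) (a r₀ : ℝ) {y : E4}
    (hy : y ∈ poincareInv Λ c ⁻¹' (Kerr.region a r₀ : Set E4)) :
    ∀ s ∈ (Set.univ : Set ℝ), MetricCoord.ricAt
      (fun z ↦ Minkowski.bilin + s • (boostedKerrBilin Λ c 1 a z - Minkowski.bilin)) y = 0 :=
  fun s _ ↦ by
  rw [← boostedKerrBilin_eq_ksFamily Λ c s a]
  exact ricAt_boostedKerr_eq_zero Λ c s a (Kerr.radius_pos_of_mem_region hy)

/-! ### Vanishing of the Landau–Lifshitz quantities of a boosted Kerr hole -/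

/-- **`Σ_α ∂_α h^{μνα} = 0` for a boosted Kerr black hole**, at every point of the boosted chart
domain, for all real `M, a, r₀` (unconditional). [cite: LandauLifshitz1975, §96 (96.8)] -/
theorem emComplex_boostedKerr_eq_zero (Λ : lorentzGroup) (c : E4) (M a r₀ : ℝ) {x : E4}
    (hx : x ∈ poincareInv Λ c ⁻¹' (Kerr.region a r₀ : Set E4)) (μ ν : Fin 4) :
    emComplex (boostedKerrBilin Λ c M a) x μ ν = 0 := by
  rw [boostedKerrBilin_eq_ksFamily Λ c M a]
  exact emComplex_ksFamily_eq_zero (isOpen_preimage_region Λ c a r₀)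
    (contDiffOn_boostedKerr_sub_minkowski Λ c a r₀)
    (fun y hy ↦ boostedKerr_nullRankOne Λ c a (Kerr.radius_pos_of_mem_region hy)) hx
    (ricAt_boostedKerr_ksFamily_eq_zero Λ c a r₀ hx) zero_mem_closure_univ_diff M μ ν

/-- **`t^{μν}_LL = 0` for a boosted Kerr black hole**: the Landau–Lifshitz pseudotensor of the
exact boosted, translated Kerr metric vanishes identically in the lab Kerr–Schild chart, for all
real `M, a, r₀` (unconditional; Gürses–Gürsey 1975, §IV). [cite: LandauLifshitz1975, §96 (96.7)] -/
theorem pseudotensor_boostedKerr_eq_zero (Λ : lorentzGroup) (c : E4) (M a r₀ : ℝ) {x : E4}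
    (hx : x ∈ poincareInv Λ c ⁻¹' (Kerr.region a r₀ : Set E4)) (μ ν : Fin 4) :
    pseudotensor (boostedKerrBilin Λ c M a) x μ ν = 0 := by
  rw [boostedKerrBilin_eq_ksFamily Λ c M a]
  exact pseudotensor_ksFamily_eq_zero (isOpen_preimage_region Λ c a r₀)
    (contDiffOn_boostedKerr_sub_minkowski Λ c a r₀)
    (fun y hy ↦ boostedKerr_nullRankOne Λ c a (Kerr.radius_pos_of_mem_region hy)) hx
    (ricAt_boostedKerr_ksFamily_eq_zero Λ c a r₀ hx) zero_mem_closure_univ_diff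
    (ricAt_boostedKerr_ksFamily_eq_zero Λ c a r₀ hx M (Set.mem_univ _)) μ ν

/-- **The LL momentum flux of a boosted Kerr black hole through any lab coordinate sphere inside
the boosted chart domain vanishes** — clause (c) of `EIHFluxEvaluation`: the EIH surface
integrals of an exact boosted Kerr hole are identically zero; for all real `M, a, r₀`
(unconditional). [cite: LandauLifshitz1975, §96 (96.11)] -/
theorem momentumFlux_boostedKerr_eq_zero (Λ : lorentzGroup) (c : E4) (M a r₀ : ℝ) {t R : ℝ}
    {ξ : E3} (hsph : ∀ y ∈ Metric.sphere ξ R,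
      E4.ofTimeSpace t y ∈ poincareInv Λ c ⁻¹' (Kerr.region a r₀ : Set E4)) (μ : Fin 4) :
    momentumFlux (boostedKerrBilin Λ c M a) t ξ R μ = 0 := by
  rw [boostedKerrBilin_eq_ksFamily Λ c M a]
  exact momentumFlux_ksFamily_eq_zero (isOpen_preimage_region Λ c a r₀)
    (contDiffOn_boostedKerr_sub_minkowski Λ c a r₀)
    (fun y hy ↦ boostedKerr_nullRankOne Λ c a (Kerr.radius_pos_of_mem_region hy))
    (fun s hs y hy ↦ ricAt_boostedKerr_ksFamily_eq_zero Λ c a r₀ hy s hs)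
    zero_mem_closure_univ_diff (Set.mem_univ M) hsph μ

/-- **The quasi-local LL four-momentum of any lab coordinate sphere inside the boosted chart
domain is conserved for a boosted Kerr black hole**: `dP^μ/dt = 0` (`R > 0`), for all real
`M, a, r₀` (unconditional). [cite: LandauLifshitz1975, §96 (96.16)] -/
theorem hasDerivAt_quasiLocalMomentum_boostedKerr (Λ : lorentzGroup) (c : E4) (M a r₀ : ℝ)
    {t R : ℝ} {ξ : E3} (hR : 0 < R) (hsph : ∀ y ∈ Metric.sphere ξ R,
      E4.ofTimeSpace t y ∈ poincareInv Λ c ⁻¹' (Kerr.region a r₀ : Set E4)) (μ : Fin 4) :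
    HasDerivAt (fun t' ↦ quasiLocalMomentum (boostedKerrBilin Λ c M a) t' ξ R μ) 0 t := by
  rw [boostedKerrBilin_eq_ksFamily Λ c M a]
  exact hasDerivAt_quasiLocalMomentum_ksFamily (isOpen_preimage_region Λ c a r₀)
    (contDiffOn_boostedKerr_sub_minkowski Λ c a r₀)
    (fun y hy ↦ boostedKerr_nullRankOne Λ c a (Kerr.radius_pos_of_mem_region hy))
    (fun s hs y hy ↦ ricAt_boostedKerr_ksFamily_eq_zero Λ c a r₀ hy s hs)
    zero_mem_closure_univ_diff M hR hsph μ

/-- **The quasi-local LL four-momentum of a boosted Kerr black hole does not depend on the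
sphere**: for two nested lab coordinate spheres (`closedBall ξ R ⊆ ball ξ' R'`, not necessarily
concentric) whose closed shell lies in the boosted chart domain at time `t`,
`P^μ(t; ξ', R') = P^μ(t; ξ, R)` — the vacuum shell Gauss law (LL (96.17)) with `t_LL ≡ 0`; this is
the sphere-independence ("dipole identity") half of clause (b); for all real `M, a, r₀`
(unconditional). [cite: LandauLifshitz1975, §96 (96.17)] -/
theorem quasiLocalMomentum_boostedKerr_shell (Λ : lorentzGroup) (c : E4) (M a r₀ : ℝ)
    {t R R' : ℝ} {ξ ξ' : E3} (hR : 0 < R) (hsub : Metric.closedBall ξ R ⊆ Metric.ball ξ' R')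
    (hKU : ∀ y ∈ Metric.closedBall ξ' R' \ Metric.ball ξ R,
      E4.ofTimeSpace t y ∈ poincareInv Λ c ⁻¹' (Kerr.region a r₀ : Set E4)) (μ : Fin 4) :
    quasiLocalMomentum (boostedKerrBilin Λ c M a) t ξ' R' μ =
      quasiLocalMomentum (boostedKerrBilin Λ c M a) t ξ R μ := by
  have hg : ContDiffOn ℝ ∞ (boostedKerrBilin Λ c M a)
      (poincareInv Λ c ⁻¹' (Kerr.region a r₀ : Set E4)) := fun x hx ↦
    (contDiffAt_boostedKerrBilin Λ c M a (Kerr.radius_pos_of_mem_region hx)).contDiffWithinAt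
  have hdet : ∀ x ∈ poincareInv Λ c ⁻¹' (Kerr.region a r₀ : Set E4),
      metricDet (boostedKerrBilin Λ c M a) x < 0 := fun x hx ↦ by
    obtain ⟨φ, ℓ, n, hn, hℓ, hK⟩ := boostedKerr_nullRankOne Λ c a (Kerr.radius_pos_of_mem_region hx)
    rw [boostedKerrBilin_eq_ksFamily Λ c M a,
      metricDet_ksFamily (K := fun z ↦ boostedKerrBilin Λ c 1 a z - Minkowski.bilin) hn hℓ hK M]
    norm_num
  have h := LLGauss.shellGaussLaw (isOpen_preimage_region Λ c a r₀) hg hdet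
    (fun x hx ↦ ricAt_boostedKerr_eq_zero Λ c M a (Kerr.radius_pos_of_mem_region hx)) hR hsub hKU μ
  rw [setIntegral_eq_zero_of_forall_eq_zero fun y hy ↦ by
    rw [pseudotensor_boostedKerr_eq_zero Λ c M a r₀ (hKU y hy), mul_zero]] at h
  exact sub_eq_zero.mp h

end Boost

end KSFlux

end Summit.FinalStateConjecture.FinalStateConjecture.Theorems

end
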